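/-
Copyright: cell `pub-ymgap` (HUMAN RULING D-0062), Track A of `YM-PLAN.md`, DAG node N20 (= NE7b); R134 seat `pub-ymgap-dag-n20-d`
(strategy s3 «alternative currency», generation 6), module 11.  Released under the licence of the surrounding project.
-/
import Summits.QuantumFields.YangMills.Theorems.BalabanUVNodesN20ByValueLabelTowerPinned
import HarnessLib

/-!
# YM-DAG node N20 (= NE7b), strategy s3, THE FOURTH CURRENCY «BY VALUE» (module 11): ANY FINITE SET OF PINNED LEVELS ON BAŁABAN's LABEL TOWER OF
# RECORD — unconditionally, one Peierls factor per pinned cube of every pinned level UP TO THE `1∕#J`-th ROOT; and the located wall of NE7b in this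
# currency, displayed as ONE property of the bare lattice Yang–Mills state: the joint coarse large-field events of `n` block-averaging levels are as
# rare as the PRODUCT of their one-level Peierls bounds (no root)

Track A of `YM-PLAN.md` (cell `pub-ymgap`, HUMAN RULING D-0062), node **N20** = spine estimate NE7b (`T4WeightBudget.RelWeightBound` — the cell
`pub-balaban`'s OWN estimate, NOT PRINTED in [Bałaban 1983–89], NOT PROVED).  Seat `pub-ymgap-dag-n20-d` (R134, s3), generation 6, module 11 (after 8
`…N20ByValueLadderCells`, 9 `…N20ByValueLabelTowerPinned`, 10 `…N20ByValueLabelTowerTwoLevels`).  Kernel theorems only: 0 `def`, 0 `sorry`, standard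
axioms; COUNT-NEUTRAL (`--supports` K3⁗ `SpineGivenEndpointR13Sep`, stmt-QuantumFields-20292, `--as helper`).  Restate-immune (no Theses import).

WHY.  Module 9 reduced the class weight of a label-family pattern pinning large-field families at the levels `j ∈ J` of seat n20-c's
`labelTowerOfRecord` to `μ_{g₀⁻²}(⋂_{j∈J} 𝓔_j)·∫ρ₀` — the Wilson–Gibbs probability of the JOINT coarse event `𝓔_j = {∀ c ∈ D_j, ∃ p′ ∈ R_j c,
ε_j ≤ |Ū^{j+1}(∂p′) − 1|}` of the pinned levels — and closed `#J = 1`; module 10 closed `#J = 2` by Cauchy–Schwarz with one Peierls factor per pinned cube.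
For GENERAL finite `J` no analysis is needed to get SOME product: `μ(⋂_j 𝓔_j) ≤ min_j μ(𝓔_j) ≤ Π_j μ(𝓔_j)^{1∕#J}` (the minimum is below the geometric mean),
and each `μ(𝓔_j)` is module 8's one-level cells bound.  THIS FILE types that — so the fourth currency now carries, for EVERY finite set of pinned levels,
an UNCONDITIONAL class weight bound on the object — and displays what it does NOT give: the product WITHOUT the root.
* §0 ★★ `sum_admS_integral_labelTower_le_setIntegral` — the reduction for ANY bounded measurable initial density `ρ ≥ 0` (e.g. the SOURCE-DRESSED
  `ρ₀ K t` of the END's cutoff ∕ source family): the class weight is at most the `ρ`-MASS `∫_S ρ dU₀` of the joint coarse event `S` — two integrals of the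
  same `ρ`, no state; ★★ `sum_admS_integral_labelTower_le_gibbsReal_mul_of_comparable` — for `a·ρ₀ ≤ ρ ≤ b·ρ₀` (`ρ₀` of record) the Gibbs reading
  `≤ (b∕a)·μ_{g₀⁻²}(S)·∫ρ dU₀`, source-uniform as long as `b∕a` is.
* §1 ★ `measureReal_forall_mem_le_prod_rpow` — for a finite measure and a non-empty finite family of events,
  `μ{∀ j ∈ J, ω ∈ E_j} ≤ Π_{j∈J} μ(E_j)^{1∕#J}`.
* §2 ★★★ **`sum_admS_integral_le_labelTower_manyLevels_byValue`** — with module 8's level-indexed constants `δ_k > 0`, `C_k ≥ 0` (functions of `N`, `F.L`,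
  `k`): for `g₀⁻² ≥ 4N`, the two ζ-laws with (O4)-measurable weights, a non-empty finite set `J` of levels `< K`, level-indexed families `D_j` of
  χ_{j+1}-cubes with regularity letters on pairwise disjoint regions `R_j c` of `≤ m_j` plaquettes and thresholds `ε_j ≥ 0`, every cutoff `K′` above `J`
  and every label-family pattern pinning `D_j` at the levels `j ∈ J` and free elsewhere,
  `Σ_{h ∈ admS … K′} ∫ eterm ρ₀ K′ h dμ_{K′} ≤ (Π_{j∈J} ((m_j·e^{C_{j+1}δ_{j+1} − δ_{j+1}g₀⁻²ε_j²∕(2N)})^{#D_j})^{1∕#J}) · ∫ ρ₀ dU₀`.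
* §3 ★★ **`sum_admS_integral_le_labelTower_prod_of_multiscalePeierls`** — THE LOCATED WALL AS ONE DISPLAYED PROPERTY OF THE BARE STATE: IF the
  Wilson–Gibbs measure at `β = g₀⁻²` obeys a MULTISCALE cells-Peierls bound with level-uniform rate `r` —
  (MSP) `μ_{g₀⁻²}(⋂_{j∈J} 𝓔_j) ≤ Π_{j∈J} (m_j·r)^{#D_j}` for the pinned families at hand —
  THEN the class weight is `≤ Π_{j∈J} (m_j·r)^{#D_j} · ∫ρ₀ dU₀`: one full Peierls factor per pinned cube of every pinned level, the quotient shape a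
  summable `W_K` is counted from (`T4WeightBudget.relWeight_le_sum_of_cover` ∕ `PinnedExtraction.relWeightBound_of_extraction` downstream, not touched).
  (MSP) is a binder (hypothesis), NOT in the tree, NOT printed as a statement; §2 and modules 9 ∕ 10 are what IS proved of it (`#J = 1`: equality of
  shape; `#J = 2`: halved tilt; general `J`: `1∕#J`-th root).

HONEST FRAMING.  Count-neutral kernel theorems + an instance with LETTER-BASED constants; the `1∕#J`-th root of §2 IS the located wall of NE7b in the
fourth currency made elementary («the tilt divided by the number of pinned levels»): a summable `W_K` needs (MSP) with NO root and a level-UNIFORM rate,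
i.e. asymptotic independence of large-field events ACROSS block-averaging scales under the bare lattice Yang–Mills state with scale-uniform Peierls
rates — Bałaban's inductive small-field analysis, print's KIND [Balaban1989LargeFieldII] (1.79) p. 383, NOT print's statement, NOT in the tree.  Residual
binders as in n20-c's modules 28–30 and module 9.  Nothing of Bałaban's is asserted; NE7b NOT PRINTED ∕ NOT PROVED; the (α)-instance 0∕1; N20 NOT
discharged (typed 28∕28, discharged count untouched); one finite four-torus programme at fixed `ε` — NOT ℝ⁴, NOT infinite volume, NOT OS, NOT a mass gap,
NOT Clay.  References (LOCATORS only; no decl carries a cite tag): T. Bałaban, CMP **119** (1988) 243–285 [Balaban1988Convergent] ((3.1)–(3.5)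
pp. 264–265); CMP **122** (1989) 175–202 [Balaban1989LargeFieldI] ((0.1) p. 175); CMP **122** (1989) 355–392 [Balaban1989LargeFieldII] ((1.79)–(1.89)
pp. 383–387).
-/

set_option autoImplicit false

noncomputable section

open scoped BigOperators

namespace Summit.QuantumFields.YangMills.BalabanUVNodes.N20ByValueLabelTowerManyLevels

open MeasureTheory
open Literature.MathematicalPhysics.QuantumFieldTheory.Balaban1983to89
open Literature.MathematicalPhysics.QuantumFieldTheory.Balaban1983to89.T4Continuum
open Literature.MathematicalPhysics.QuantumFieldTheory.Balaban1983to89.Node00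
open Summit.QuantumFields.BalabanUV.T4Continuum.B16HistoryReprChain
open Summit.QuantumFields.BalabanUV.T4Continuum.NE7b.PrefixExtraction (admS)
open Summit.QuantumFields.BalabanUV.T4Continuum.ShellMeasureAverageIterate (iterMap)
open Summit.QuantumFields.YangMills.BalabanUVNodes.N20LCSLabelTower
open Summit.QuantumFields.YangMills.BalabanUVNodes.N20LCSLabelTowerClassWeight (labelChi_eq hunit_labelTower)
open Summit.QuantumFields.YangMills.BalabanUVNodes.N20LCSLabelTowerByValue (good_comp_avOfRecord hmod_labelTower)
open Summit.QuantumFields.YangMills.BalabanUVNodes.N20LCSLargeFieldFamilies (measurableSet_forall_exists_largeField)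
open Summit.QuantumFields.YangMills.BalabanUVNodes.N20LCSLargeFieldFirstStep (setIntegral_rhoZeroOfRecord)
open Summit.QuantumFields.YangMills.BalabanUVNodes.N20ByValueTelescoping (good_prod_iterMap)
open Summit.QuantumFields.YangMills.BalabanUVNodes.N20ByValueExtraction (sum_admS_integral_le_integral_prod)
open Summit.QuantumFields.YangMills.BalabanUVNodes.N20ByValueLadderCells (gibbsMeasure_largeFieldCells_dist1_iterAvgFun_le)
open Summit.QuantumFields.YangMills.BalabanUVNodes.N20ByValueLabelTowerPinned
  (sum_labelChi_pinned_le_indicator sum_labelChi_free_eq_one indicator_comp_avg_good measurableSet_jointEvent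
    sum_admS_integral_labelTower_le_gibbsReal_mul iterMap_avOfRecord_eq)

/-! ## §0 The reduction for ANY initial density: the class weight is at most the `ρ`-mass of the joint coarse event -/

section AnyDensity

variable (F : T4Family) (N : ℕ) [NeZero N] (ν : Stage7Numerics) (M : ℕ) (p : B12.RunParams) (g : ℕ → ℝ) {A₁ : ℝ} {ζ : ZetaOfRecord F N ν M}

open Classical in
/-- ★★ **THE REDUCTION FOR ANY INITIAL DENSITY** (module 9's `sum_admS_integral_labelTower_le_gibbsReal_mul` before the Gibbs reading): for EVERY bounded
measurable `ρ ≥ 0` on the bare torus field — in particular a SOURCE-DRESSED initial density `ρ₀ K t` of the END's cutoff ∕ source family — the class weight of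
a label-family pattern pinning `D j` at the levels `j ∈ J` (regularity letters `R j`, thresholds `ε j`) and free elsewhere is at most the `ρ`-MASS OF THE
JOINT COARSE LARGE-FIELD EVENT of its pinned levels:
`Σ_{h ∈ admS (labelTowerOfRecord A₁ ζ) (labelPattern E) K′} ∫ eterm ρ K′ h dμ_{K′} ≤ ∫_{S} ρ dU₀`,
`S = {U | ∀ j ∈ J, j < K′ → ∀ c ∈ D j, ∃ p′ ∈ R j c, ε j ≤ |Ū^{j+1}U(∂p′) − 1|}` — no state, no Gibbs measure, no source-uniformity issue: the
display is an inequality between two integrals of the SAME `ρ`. [folklore] -/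
theorem sum_admS_integral_labelTower_le_setIntegral (A₁ : ℝ) (hζu : IsZetaUnity F N ν M ζ) (hζ : IsZetaAbsLeOne F N ν M ζ)
    (hω : ∀ (k : ℕ) (s : SeqOfRecord F ν M g p.K k) (t : LbOfRecord F ν p g k),
      Measurable fun z : cfgOfRecord F N p.K (k + 1) × cfgOfRecord F N p.K k => ωOfRecord F N ν M p g k A₁ ζ s t z.2 z.1)
    (J : Finset ℕ) (D : (j : ℕ) → Finset (Iχ F ν p g j)) (R : (j : ℕ) → Iχ F ν p g j → Finset (Plaq (F.P p.K) (j + 1))) (ε : ℕ → ℝ)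
    (hreg : ∀ j ∈ J, ∀ c ∈ D j, ∀ V' : GaugeField (F.P p.K) (j + 1) (SU N),
      (∀ p' ∈ R j c, dist1 (GaugeField.plaqHol V' p') < ε j) → chiFactor F N ν p g j c V' = 1)
    (E : (j : ℕ) → (Fin j → LabelPat F ν p g) → Finset (LbOfRecord F ν p g j))
    (hEpin : ∀ j ∈ J, ∀ h t, t ∈ E j h → D j ⊆ t.1) (hEfree : ∀ j, j ∉ J → ∀ h, E j h = Finset.univ) (K' : ℕ)
    {ρ : cfgOfRecord F N p.K 0 → ℝ} (hρ : (bddMeas (cfgOfRecord F N p.K 0)).Gd ρ) (h0 : ∀ U, 0 ≤ ρ U) :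
    ∑ h ∈ admS (labelTowerOfRecord F N ν M p g A₁ ζ) (labelPattern F ν p g E) K',
        ∫ x, (labelTowerOfRecord F N ν M p g A₁ ζ).eterm ρ K' h x ∂(lawOfRecord F N p.K K') ≤
      ∫ U in {U | ∀ j ∈ J, j < K' → ∀ c ∈ D j, ∃ p' ∈ R j c,
          ε j ≤ dist1 (GaugeField.plaqHol (iterMap (fun i => (avOfRecord F N p.K i).avg) (j + 1) U) p')},
        ρ U ∂(fieldMeasure (F.P p.K) 0 (SU N)) := by
  set T := labelTowerOfRecord F N ν M p g A₁ ζ with hT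
  -- the coarse events and the letters: indicators at the pinned levels, `1` at the free ones
  let A : (j : ℕ) → Set (cfgOfRecord F N p.K (j + 1)) := fun j =>
    {V' | ∀ c ∈ D j, ∃ p' ∈ R j c, ε j ≤ dist1 (GaugeField.plaqHol V' p')}
  have hA : ∀ j, MeasurableSet (A j) := fun j => measurableSet_forall_exists_largeField F N ν p g j (D j) (R j) (ε j)
  let e : (j : ℕ) → cfgOfRecord F N p.K j → ℝ := fun j U =>
    if j ∈ J then (A j).indicator (fun _ => (1 : ℝ)) ((avOfRecord F N p.K j).avg U) else 1
  have he : ∀ j U, 0 ≤ e j U := fun j U => by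
    by_cases hj : j ∈ J
    · simp only [e, if_pos hj]; exact Set.indicator_nonneg (fun _ _ => zero_le_one) _
    · simp only [e, if_neg hj]; exact zero_le_one
  have he1 : ∀ j U, e j U ≤ 1 := fun j U => by
    by_cases hj : j ∈ J
    · simp only [e, if_pos hj]; exact Set.indicator_le_self' (fun _ _ => zero_le_one) _
    · simp only [e, if_neg hj]; exact le_rfl
  have heg : ∀ j, (bddMeas (cfgOfRecord F N p.K j)).Gd (e j) := fun j => by
    by_cases hj : j ∈ J
    · simpa only [e, if_pos hj] using indicator_comp_avg_good F N p j (hA j)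
    · simpa only [e, if_neg hj] using (bddMeas (cfgOfRecord F N p.K j)).const 1
  have hpin : ∀ (j : ℕ) (h : Fin j → LabelPat F ν p g), j < K' → h ∈ admS T (labelPattern F ν p g E) j →
      ∀ U, ∑ q ∈ T.branch j h ∩ labelPattern F ν p g E j h, labelChi F N ν M p g A₁ ζ j h q U ≤ e j U := by
    intro j h _ _ U
    by_cases hj : j ∈ J
    · simp only [e, if_pos hj]
      exact sum_labelChi_pinned_le_indicator F N ν M p g A₁ hζu hζ E j h (D j) (hEpin j hj h) (R j) (ε j) (hreg j hj) U
    · simp only [e, if_neg hj]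
      exact (sum_labelChi_free_eq_one F N ν M p g A₁ hζu hζ E j h (hEfree j hj h) U).le
  have key := sum_admS_integral_le_integral_prod T (lawOfRecord F N p.K) (fun j => (avOfRecord F N p.K j).avg)
    (labelChi F N ν M p g A₁ ζ) (labelPattern F ν p g E) e (fun j m hm => good_comp_avOfRecord F N p.K j m hm)
    (labelChi_good F N ν M p g hω) (labelChi_nonneg F N ν M p g) (hmod_labelTower F N ν M p g hω) hρ h0
    (fun f hf => integrable_of_bddMeas _ hf) he heg K' hpin
  rw [lawOfRecord_zero] at key
  refine key.trans ?_
  set S : Set (cfgOfRecord F N p.K 0) := {U | ∀ j ∈ J, j < K' → ∀ c ∈ D j, ∃ p' ∈ R j c,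
    ε j ≤ dist1 (GaugeField.plaqHol (iterMap (fun i => (avOfRecord F N p.K i).avg) (j + 1) U) p')} with hS
  have hSm : MeasurableSet S := measurableSet_jointEvent F N ν p g J D R ε K'
  have hρint : Integrable ρ (fieldMeasure (F.P p.K) 0 (SU N)) := integrable_of_bddMeas _ hρ
  have hpt : ∀ U, (∏ j ∈ Finset.range K', e j (iterMap (fun i => (avOfRecord F N p.K i).avg) j U)) * ρ U ≤ S.indicator ρ U := by
    intro U
    by_cases hU : U ∈ S
    · rw [Set.indicator_of_mem hU]
      exact mul_le_of_le_one_left (h0 U) (Finset.prod_le_one (fun j _ => he j _) fun j _ => he1 j _)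
    · rw [Set.indicator_of_notMem hU]
      have hU' : ∃ j ∈ J, j < K' ∧ ¬ ∀ c ∈ D j, ∃ p' ∈ R j c,
          ε j ≤ dist1 (GaugeField.plaqHol (iterMap (fun i => (avOfRecord F N p.K i).avg) (j + 1) U) p') := by
        by_contra hcon
        push Not at hcon
        exact hU fun j hj hjK => hcon j hj hjK
      obtain ⟨j, hj, hjK, hnot⟩ := hU'
      have hnot' : (avOfRecord F N p.K j).avg (iterMap (fun i => (avOfRecord F N p.K i).avg) j U) ∉ A j := hnot
      have hz : e j (iterMap (fun i => (avOfRecord F N p.K i).avg) j U) = 0 := by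
        simp only [e, if_pos hj]
        exact Set.indicator_of_notMem hnot' _
      rw [Finset.prod_eq_zero (Finset.mem_range.2 hjK) hz, zero_mul]
  calc ∫ U, (∏ j ∈ Finset.range K', e j (iterMap (fun i => (avOfRecord F N p.K i).avg) j U)) * ρ U ∂(fieldMeasure (F.P p.K) 0 (SU N))
      ≤ ∫ U, S.indicator ρ U ∂(fieldMeasure (F.P p.K) 0 (SU N)) :=
        integral_mono (integrable_of_bddMeas _ ((bddMeas _).mul
          (good_prod_iterMap (𝒢 := fun j => bddMeas (cfgOfRecord F N p.K j)) (avg := fun j => (avOfRecord F N p.K j).avg)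
            (fun j m hm => good_comp_avOfRecord F N p.K j m hm) heg K') hρ)) (hρint.indicator hSm) hpt
    _ = ∫ U in S, ρ U ∂(fieldMeasure (F.P p.K) 0 (SU N)) := integral_indicator hSm

open Classical in
/-- ★★ **SOURCE-DRESSED INITIAL DENSITIES COMPARABLE TO THE RECORD's** (the END asks its display UNIFORMLY in the source `|t| ≤ l₀`): if a bounded measurable
`ρ` satisfies `a·ρ₀ ≤ ρ ≤ b·ρ₀` pointwise for the initial density of record `ρ₀ = rhoZeroOfRecord g₀ E₀` and constants `0 < a`, `0 ≤ b` (e.g. `ρ = e^{tO}·ρ₀`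
with a bounded observable, `a = e^{−l₀‖O‖}`, `b = e^{l₀‖O‖}`), then the class weight FROM `ρ` is at most `(b∕a) · μ_{g₀⁻²}(S) · ∫ ρ dU₀` with the same
joint coarse event `S` — the Gibbs reading of §0's `ρ`-mass, source-uniform as long as `b∕a` is. [folklore] -/
theorem sum_admS_integral_labelTower_le_gibbsReal_mul_of_comparable (g₀ E₀ A₁ : ℝ) (hζu : IsZetaUnity F N ν M ζ) (hζ : IsZetaAbsLeOne F N ν M ζ)
    (hω : ∀ (k : ℕ) (s : SeqOfRecord F ν M g p.K k) (t : LbOfRecord F ν p g k),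
      Measurable fun z : cfgOfRecord F N p.K (k + 1) × cfgOfRecord F N p.K k => ωOfRecord F N ν M p g k A₁ ζ s t z.2 z.1)
    (J : Finset ℕ) (D : (j : ℕ) → Finset (Iχ F ν p g j)) (R : (j : ℕ) → Iχ F ν p g j → Finset (Plaq (F.P p.K) (j + 1))) (ε : ℕ → ℝ)
    (hreg : ∀ j ∈ J, ∀ c ∈ D j, ∀ V' : GaugeField (F.P p.K) (j + 1) (SU N),
      (∀ p' ∈ R j c, dist1 (GaugeField.plaqHol V' p') < ε j) → chiFactor F N ν p g j c V' = 1)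
    (E : (j : ℕ) → (Fin j → LabelPat F ν p g) → Finset (LbOfRecord F ν p g j))
    (hEpin : ∀ j ∈ J, ∀ h t, t ∈ E j h → D j ⊆ t.1) (hEfree : ∀ j, j ∉ J → ∀ h, E j h = Finset.univ) (K' : ℕ)
    {ρ : cfgOfRecord F N p.K 0 → ℝ} (hρ : (bddMeas (cfgOfRecord F N p.K 0)).Gd ρ) {a b : ℝ} (ha : 0 < a) (hb : 0 ≤ b)
    (hab : ∀ U, a * rhoZeroOfRecord F N p.K g₀ E₀ U ≤ ρ U ∧ ρ U ≤ b * rhoZeroOfRecord F N p.K g₀ E₀ U) :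
    ∑ h ∈ admS (labelTowerOfRecord F N ν M p g A₁ ζ) (labelPattern F ν p g E) K',
        ∫ x, (labelTowerOfRecord F N ν M p g A₁ ζ).eterm ρ K' h x ∂(lawOfRecord F N p.K K') ≤
      (b / a) * (T4GenFunBounds.gibbsMeasure (F.P p.K) (g₀⁻¹ ^ 2) : Measure (cfgOfRecord F N p.K 0)).real
          {U | ∀ j ∈ J, j < K' → ∀ c ∈ D j, ∃ p' ∈ R j c,
            ε j ≤ dist1 (GaugeField.plaqHol (iterMap (fun i => (avOfRecord F N p.K i).avg) (j + 1) U) p')} *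
        ∫ U, ρ U ∂(fieldMeasure (F.P p.K) 0 (SU N)) := by
  set ρ₀ := rhoZeroOfRecord F N p.K g₀ E₀ with hρ₀
  set S : Set (cfgOfRecord F N p.K 0) := {U | ∀ j ∈ J, j < K' → ∀ c ∈ D j, ∃ p' ∈ R j c,
    ε j ≤ dist1 (GaugeField.plaqHol (iterMap (fun i => (avOfRecord F N p.K i).avg) (j + 1) U) p')} with hS
  have hSm : MeasurableSet S := measurableSet_jointEvent F N ν p g J D R ε K'
  have hρ0pos : ∀ U, 0 < ρ₀ U := fun U => rhoZeroOfRecord_pos F N p.K g₀ E₀ U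
  have h0 : ∀ U, 0 ≤ ρ U := fun U => (mul_pos ha (hρ0pos U)).le.trans (hab U).1
  have hρ₀good : (bddMeas (cfgOfRecord F N p.K 0)).Gd ρ₀ := rhoZeroOfRecord_good F N p.K g₀ E₀
  have hρ₀int : Integrable ρ₀ (fieldMeasure (F.P p.K) 0 (SU N)) := integrable_of_bddMeas _ hρ₀good
  have hρint : Integrable ρ (fieldMeasure (F.P p.K) 0 (SU N)) := integrable_of_bddMeas _ hρ
  have hμ0 : 0 ≤ (T4GenFunBounds.gibbsMeasure (F.P p.K) (g₀⁻¹ ^ 2) : Measure (cfgOfRecord F N p.K 0)).real S := measureReal_nonneg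
  -- step 1: the `ρ`-mass of the joint event (§0)
  have h1 := sum_admS_integral_labelTower_le_setIntegral F N ν M p g A₁ hζu hζ hω J D R ε hreg E hEpin hEfree K' hρ h0
  refine h1.trans ?_
  -- step 2: `∫_S ρ ≤ b ∫_S ρ₀ = b μ(S) ∫ρ₀ ≤ (b/a) μ(S) ∫ ρ`
  have h2 : ∫ U in S, ρ U ∂(fieldMeasure (F.P p.K) 0 (SU N)) ≤ b * ∫ U in S, ρ₀ U ∂(fieldMeasure (F.P p.K) 0 (SU N)) := by
    rw [← integral_const_mul]
    exact setIntegral_mono_on hρint.integrableOn (hρ₀int.const_mul b).integrableOn hSm fun U _ => (hab U).2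
  have h3 : ∫ U, ρ₀ U ∂(fieldMeasure (F.P p.K) 0 (SU N)) ≤ a⁻¹ * ∫ U, ρ U ∂(fieldMeasure (F.P p.K) 0 (SU N)) := by
    rw [← integral_const_mul]
    refine integral_mono hρ₀int (hρint.const_mul _) fun U => ?_
    show ρ₀ U ≤ a⁻¹ * ρ U
    rw [le_inv_mul_iff₀ ha]
    exact (hab U).1
  calc ∫ U in S, ρ U ∂(fieldMeasure (F.P p.K) 0 (SU N))
      ≤ b * ∫ U in S, ρ₀ U ∂(fieldMeasure (F.P p.K) 0 (SU N)) := h2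
    _ = b * ((T4GenFunBounds.gibbsMeasure (F.P p.K) (g₀⁻¹ ^ 2) : Measure (cfgOfRecord F N p.K 0)).real S *
          ∫ U, ρ₀ U ∂(fieldMeasure (F.P p.K) 0 (SU N))) := by rw [setIntegral_rhoZeroOfRecord F N p.K g₀ E₀ hSm]
    _ ≤ b * ((T4GenFunBounds.gibbsMeasure (F.P p.K) (g₀⁻¹ ^ 2) : Measure (cfgOfRecord F N p.K 0)).real S *
          (a⁻¹ * ∫ U, ρ U ∂(fieldMeasure (F.P p.K) 0 (SU N)))) :=
        mul_le_mul_of_nonneg_left (mul_le_mul_of_nonneg_left h3 hμ0) hb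
    _ = (b / a) * (T4GenFunBounds.gibbsMeasure (F.P p.K) (g₀⁻¹ ^ 2) : Measure (cfgOfRecord F N p.K 0)).real S *
          ∫ U, ρ U ∂(fieldMeasure (F.P p.K) 0 (SU N)) := by rw [div_eq_mul_inv]; ring

end AnyDensity

/-! ## §1 The probability of a finite intersection is below the geometric mean of the probabilities -/

section GeometricMean

variable {Ω : Type*} [MeasurableSpace Ω] (μ : Measure Ω) [IsFiniteMeasure μ]

/-- ★ **A FINITE INTERSECTION IS AT MOST THE GEOMETRIC MEAN OF ITS EVENTS**: for a finite measure `μ`, a non-empty finite index set `J` and events `E j`,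
`μ{ω | ∀ j ∈ J, ω ∈ E j} ≤ Π_{j∈J} μ(E j)^{1∕#J}` (the intersection lies in every `E j`, so its `#J`-th power is at most the product). [folklore] -/
theorem measureReal_forall_mem_le_prod_rpow {β : Type*} (J : Finset β) (hJ : J.Nonempty) (E : β → Set Ω) :
    μ.real {ω | ∀ j ∈ J, ω ∈ E j} ≤ ∏ j ∈ J, (μ.real (E j)) ^ ((J.card : ℝ)⁻¹) := by
  set a := μ.real {ω | ∀ j ∈ J, ω ∈ E j} with ha_def
  have ha : 0 ≤ a := measureReal_nonneg
  have hle : ∀ j ∈ J, a ≤ μ.real (E j) := fun j hj => measureReal_mono (fun ω hω => hω j hj) (measure_ne_top μ _)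
  have hn : J.card ≠ 0 := Finset.card_ne_zero.2 hJ
  have hpow : a ^ J.card ≤ ∏ j ∈ J, μ.real (E j) := by
    rw [← Finset.prod_const]
    exact Finset.prod_le_prod (fun _ _ => ha) hle
  calc a = (a ^ J.card) ^ ((J.card : ℝ)⁻¹) := (Real.pow_rpow_inv_natCast ha hn).symm
    _ ≤ (∏ j ∈ J, μ.real (E j)) ^ ((J.card : ℝ)⁻¹) := Real.rpow_le_rpow (pow_nonneg ha _) hpow (inv_nonneg.2 (Nat.cast_nonneg _))
    _ = ∏ j ∈ J, (μ.real (E j)) ^ ((J.card : ℝ)⁻¹) := (Real.finsetProd_rpow J _ (fun j _ => measureReal_nonneg) _).symm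

end GeometricMean

/-! ## §2 Any finite set of pinned levels on the label tower of record, unconditionally -/

section ManyLevels

variable (F : T4Family) (N : ℕ) [NeZero N] (ν : Stage7Numerics) (M : ℕ) (p : B12.RunParams) (g : ℕ → ℝ)

open Classical in
/-- ★★★ **KEYS PINNED AT ANY FINITE SET OF LEVELS ON BAŁABAN's LABEL TOWER, BY VALUE — one Peierls factor per pinned cube of every pinned level, up to the
`1∕#J`-th root.**  There are level-indexed constants `δ_k > 0`, `C_k ≥ 0` (module 8's `gibbsMeasure_largeFieldCells_dist1_iterAvgFun_le` at level `k`,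
functions of `N`, `F.L`, `k`) such that: for `g₀⁻² ≥ 4N`, every `E₀`, `A₁`, every `ζ` obeying the two displayed laws with (O4)-measurable label weights, every
NON-EMPTY finite set `J` of levels `< K`, level-indexed finite families `D j` of χ_{j+1}-cubes with regularity letters on pairwise disjoint regions `R j c`
of at most `m j` level-`(j+1)` plaquettes and thresholds `ε j ≥ 0` (`j ∈ J`), every cutoff `K′` with `j < K′` for all `j ∈ J`, and every label-family
pattern `E` pinning `D j` at the levels `j ∈ J` and free at every other level:
`Σ_{h ∈ admS (labelTowerOfRecord A₁ ζ) (labelPattern E) K′} ∫ eterm ρ₀ K′ h dμ_{K′}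
   ≤ (Π_{j∈J} ((m_j·e^{C_{j+1}δ_{j+1} − δ_{j+1}g₀⁻²ε_j²∕(2N)})^{#D_j})^{1∕#J}) · ∫ ρ₀ dU₀`
(module 9's reduction + §1 + module 8 §2 at every pinned level). [folklore] -/
theorem sum_admS_integral_le_labelTower_manyLevels_byValue :
    ∃ δf : ℕ → ℝ, (∀ k, 0 < δf k) ∧ ∃ Cf : ℕ → ℝ, (∀ k, 0 ≤ Cf k) ∧ ∀ (g₀ E₀ A₁ : ℝ), 4 * N ≤ g₀⁻¹ ^ 2 →
      ∀ {ζ : ZetaOfRecord F N ν M}, IsZetaUnity F N ν M ζ → IsZetaAbsLeOne F N ν M ζ →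
      (∀ (k : ℕ) (s : SeqOfRecord F ν M g p.K k) (t : LbOfRecord F ν p g k),
        Measurable fun z : cfgOfRecord F N p.K (k + 1) × cfgOfRecord F N p.K k => ωOfRecord F N ν M p g k A₁ ζ s t z.2 z.1) →
      ∀ (J : Finset ℕ), J.Nonempty → (∀ j ∈ J, j < p.K) →
      ∀ (D : (j : ℕ) → Finset (Iχ F ν p g j)) (R : (j : ℕ) → Iχ F ν p g j → Finset (Plaq (F.P p.K) (j + 1))) (m : ℕ → ℕ) (ε : ℕ → ℝ),
        (∀ j ∈ J, 0 ≤ ε j) → (∀ j ∈ J, ∀ c ∈ D j, (R j c).card ≤ m j) →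
        (∀ j ∈ J, ∀ c₁ ∈ D j, ∀ c₂ ∈ D j, c₁ ≠ c₂ → Disjoint (R j c₁) (R j c₂)) →
        (∀ j ∈ J, ∀ c ∈ D j, ∀ V' : GaugeField (F.P p.K) (j + 1) (SU N),
          (∀ p' ∈ R j c, dist1 (GaugeField.plaqHol V' p') < ε j) → chiFactor F N ν p g j c V' = 1) →
      ∀ (K' : ℕ), (∀ j ∈ J, j < K') → ∀ (E : (j : ℕ) → (Fin j → LabelPat F ν p g) → Finset (LbOfRecord F ν p g j)),
        (∀ j ∈ J, ∀ h t, t ∈ E j h → D j ⊆ t.1) → (∀ j, j ∉ J → ∀ h, E j h = Finset.univ) →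
        ∑ h ∈ admS (labelTowerOfRecord F N ν M p g A₁ ζ) (labelPattern F ν p g E) K',
            ∫ x, (labelTowerOfRecord F N ν M p g A₁ ζ).eterm (rhoZeroOfRecord F N p.K g₀ E₀) K' h x ∂(lawOfRecord F N p.K K') ≤
          (∏ j ∈ J, (((m j : ℝ) * Real.exp (Cf (j + 1) * δf (j + 1) -
              δf (j + 1) * g₀⁻¹ ^ 2 * (ε j ^ 2 / (2 * (Fintype.card (Fin N) : ℝ))))) ^ (D j).card) ^ ((J.card : ℝ)⁻¹)) *
            ∫ U, rhoZeroOfRecord F N p.K g₀ E₀ U ∂(fieldMeasure (F.P p.K) 0 (SU N)) := by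
  have h8 := fun k => gibbsMeasure_largeFieldCells_dist1_iterAvgFun_le N F.L k
  choose δf hδf Cf hCf h8 using h8
  refine ⟨δf, hδf, Cf, hCf, fun g₀ E₀ A₁ hg ζ hζu hζ hω J hJ hJK D R m ε hε hm hdisj hreg K' hJK' E hEpin hEfree => ?_⟩
  have key := sum_admS_integral_labelTower_le_gibbsReal_mul F N ν M p g g₀ E₀ A₁ hζu hζ hω J D R ε hreg E hEpin hEfree K'
  refine key.trans (mul_le_mul_of_nonneg_right ?_ (integral_nonneg fun U => (rhoZeroOfRecord_pos F N p.K g₀ E₀ U).le))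
  haveI := T4GenFunBounds.isProbabilityMeasure_gibbsMeasure (G := SU N) (F.P p.K) (sq_nonneg g₀⁻¹)
  -- the one-level cells events of the pinned levels, read on the bare field
  let Ev : ℕ → Set (cfgOfRecord F N p.K 0) := fun j =>
    {U : GaugeField (F.P p.K) 0 (Matrix.specialUnitaryGroup (Fin N) ℂ) | ∀ c ∈ D j, ∃ p' ∈ R j c,
      ε j ≤ dist1 (GaugeField.plaqHol
        (Averaging.iter (fun _ => BlockAveraging.blockAvg (ExpMeanLog.expMeanLogSU (n := Fin N))) (j + 1) U) p')}
  have hsub : {U : cfgOfRecord F N p.K 0 | ∀ j ∈ J, j < K' → ∀ c ∈ D j, ∃ p' ∈ R j c,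
        ε j ≤ dist1 (GaugeField.plaqHol (iterMap (fun i => (avOfRecord F N p.K i).avg) (j + 1) U) p')} ⊆
      {U | ∀ j ∈ J, U ∈ Ev j} := by
    intro U hU j hj c hc
    obtain ⟨p', hp', hle⟩ := hU j hj (hJK' j hj) c hc
    refine ⟨p', hp', ?_⟩
    rw [iterMap_avOfRecord_eq] at hle
    exact hle
  refine (measureReal_mono hsub (measure_ne_top _ _)).trans ?_
  refine (measureReal_forall_mem_le_prod_rpow _ J hJ Ev).trans ?_
  -- each pinned level: module 8's cells bound at level `j + 1`, under the root
  refine Finset.prod_le_prod (fun j _ => Real.rpow_nonneg measureReal_nonneg _) fun j hj => ?_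
  refine Real.rpow_le_rpow measureReal_nonneg ?_ (inv_nonneg.2 (Nat.cast_nonneg _))
  have hmK : j + 1 ≤ (F.P p.K).m + (F.P p.K).K := by
    have := hJK j hj
    simp only [T4Family.P_m, T4Family.P_K]; omega
  exact h8 (j + 1) (F.P p.K) (T4Family.P_d F p.K) (T4Family.P_L F p.K) hmK (g₀⁻¹ ^ 2) hg (ε j) (hε j hj) (D j) (R j) (m j)
    (hm j hj) (hdisj j hj)

end ManyLevels

/-! ## §3 The located wall, displayed: a multiscale cells-Peierls bound of the bare state gives the full product -/

section Wall

variable (F : T4Family) (N : ℕ) [NeZero N] (ν : Stage7Numerics) (M : ℕ) (p : B12.RunParams) (g : ℕ → ℝ)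

open Classical in
/-- ★★ **THE CLASS WEIGHT IS THE FULL PRODUCT OF PEIERLS FACTORS IF THE BARE STATE OBEYS A MULTISCALE CELLS-PEIERLS BOUND** (the located wall of NE7b in the
fourth currency, as ONE displayed property of the Wilson–Gibbs measure of the bare lattice Yang–Mills field on the torus — a HYPOTHESIS, not in the
tree, not printed as a statement).  For `g₀`, `E₀`, `A₁`, `ζ` with the two laws and (O4), a finite set `J` of pinned levels with families `D j`, regions
`R j c`, thresholds `ε j` obeying the regularity letters, sizes `m j` and a rate `r ≥ 0`: IF
  (MSP) `μ_{g₀⁻²}{U | ∀ j ∈ J, j < K′ → ∀ c ∈ D j, ∃ p′ ∈ R j c, ε j ≤ |Ū^{j+1}U(∂p′) − 1|} ≤ Π_{j ∈ J, j < K′} (m_j·r)^{#D_j}`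
THEN for every label-family pattern pinning `D j` at the levels `j ∈ J` and free elsewhere,
`Σ_{h ∈ admS … K′} ∫ eterm ρ₀ K′ h dμ_{K′} ≤ (Π_{j ∈ J, j < K′} (m_j·r)^{#D_j}) · ∫ ρ₀ dU₀` — module 9's reduction, one line.  What §2 and modules 9 ∕ 10
PROVE of (MSP): `#J = 1` exactly (level-dependent rate), `#J = 2` with halved tilt, general `J` up to the `1∕#J`-th root. [folklore] -/
theorem sum_admS_integral_le_labelTower_prod_of_multiscalePeierls (g₀ E₀ A₁ : ℝ) {ζ : ZetaOfRecord F N ν M}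
    (hζu : IsZetaUnity F N ν M ζ) (hζ : IsZetaAbsLeOne F N ν M ζ)
    (hω : ∀ (k : ℕ) (s : SeqOfRecord F ν M g p.K k) (t : LbOfRecord F ν p g k),
      Measurable fun z : cfgOfRecord F N p.K (k + 1) × cfgOfRecord F N p.K k => ωOfRecord F N ν M p g k A₁ ζ s t z.2 z.1)
    (J : Finset ℕ) (D : (j : ℕ) → Finset (Iχ F ν p g j)) (R : (j : ℕ) → Iχ F ν p g j → Finset (Plaq (F.P p.K) (j + 1))) (ε : ℕ → ℝ)
    (hreg : ∀ j ∈ J, ∀ c ∈ D j, ∀ V' : GaugeField (F.P p.K) (j + 1) (SU N),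
      (∀ p' ∈ R j c, dist1 (GaugeField.plaqHol V' p') < ε j) → chiFactor F N ν p g j c V' = 1)
    (m : ℕ → ℕ) {r : ℝ} (K' : ℕ)
    (hMSP : (T4GenFunBounds.gibbsMeasure (F.P p.K) (g₀⁻¹ ^ 2) : Measure (cfgOfRecord F N p.K 0)).real
        {U | ∀ j ∈ J, j < K' → ∀ c ∈ D j, ∃ p' ∈ R j c,
          ε j ≤ dist1 (GaugeField.plaqHol (iterMap (fun i => (avOfRecord F N p.K i).avg) (j + 1) U) p')} ≤
      ∏ j ∈ J.filter (· < K'), ((m j : ℝ) * r) ^ (D j).card)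
    (E : (j : ℕ) → (Fin j → LabelPat F ν p g) → Finset (LbOfRecord F ν p g j))
    (hEpin : ∀ j ∈ J, ∀ h t, t ∈ E j h → D j ⊆ t.1) (hEfree : ∀ j, j ∉ J → ∀ h, E j h = Finset.univ) :
    ∑ h ∈ admS (labelTowerOfRecord F N ν M p g A₁ ζ) (labelPattern F ν p g E) K',
        ∫ x, (labelTowerOfRecord F N ν M p g A₁ ζ).eterm (rhoZeroOfRecord F N p.K g₀ E₀) K' h x ∂(lawOfRecord F N p.K K') ≤
      (∏ j ∈ J.filter (· < K'), ((m j : ℝ) * r) ^ (D j).card) *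
        ∫ U, rhoZeroOfRecord F N p.K g₀ E₀ U ∂(fieldMeasure (F.P p.K) 0 (SU N)) :=
  (sum_admS_integral_labelTower_le_gibbsReal_mul F N ν M p g g₀ E₀ A₁ hζu hζ hω J D R ε hreg E hEpin hEfree K').trans
    (mul_le_mul_of_nonneg_right hMSP (integral_nonneg fun U => (rhoZeroOfRecord_pos F N p.K g₀ E₀ U).le))

end Wall

end Summit.QuantumFields.YangMills.BalabanUVNodes.N20ByValueLabelTowerManyLevels

end
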